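import Mathlib
import HarnessLib
import Summits.Langlands.Langlands.Theses.ParityBlindBianchi
import Summits.Langlands.Langlands.Theses.RuelleTorsionArtinWeight
import Summits.Langlands.Langlands.Theorems.ParityBlindBianchiArtinWeightRealisationLevelOddBaseChangeSector
import Literature.NumberTheory.GaloisRepresentations.EvenGaloisRep
import Literature.NumberTheory.GaloisRepresentations.ProjectiveTypeProofs
import Literature.NumberTheory.GaloisRepresentations.FramedRepDualIrreducible
import Literature.NumberTheory.NumberFields.ConjugationSolvable

/-!
# The base-change sector of R′ of EITHER parity, strong Artin over `ℚ` for `GL₂` from the route's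
own target, and R′ on the route's literal instance — helper file (`--supports stmt-Langlands-15111`),
line `Sketch`, continuation lead c15

Crux R′ = `ParityBlindBianchi.ArtinWeightRealisationLevel`.  c14 closed the ODD base-change sector
(`…OddBaseChangeSector`, p123485) from odd strong Artin over `ℚ`.  Here the oddness bookkeeping is
removed:

* `eventually_satakeFrobCompatibleAt_restrictField_of_piOfDualTransport` — the base-change chain
  (contragredient transport `τ = ι ∘ ρ^∨`, `π_ℚ := π(τ)`, inert non-twist witness, CUSPIDAL weak
  base change `BC_K(π_ℚ)` by Arthur–Clozel 4.2 (a), ascent, dictionary) for ANY finite-image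
  `ρ : Γ_ℚ → GL₂(ℚ̄_p)` with `ρ|_{Γ_K}` irreducible, POINTED: strong Artin is assumed only for the
  transports `τ` of the given `ρ`; `…_of_strongArtin` — the same with strong Artin over `ℚ` for all
  irreducible two-dimensional Artin representations displayed;
* `isEven_of_not_isOdd_rat` (parity dichotomy over `ℚ`), `isIcosahedralType_of_not_isSolvable`
  (Klein's classification, PROVED in the tree: irreducible + insoluble projective image ⇒ `A₅`),
  `strongArtin_rat_two_of_target` — LT + KW + Booker + the route's TARGET
  `EvenIcosahedralStrongArtin` ⇒ strong Artin over `ℚ` for EVERY irreducible `Γ_ℚ → GL₂(ℂ)`;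
* `even_route_sector_of_target` — on the literal instance the route consumes (`σ` a `p`-adic model
  of `ρ|_{Γ_K}`, `ρ` irreducible, projectively `A₅`, EVEN) the conclusion of R′ follows from the
  TARGET + Arthur–Clozel 4.2 (a) + JL alone.  With `target_of_even_route_sector` (`…RouteSector`,
  p125161: E1′ → E2′ → R′|that instance → D′ → Target) the part of R′ the route consumes is
  EQUIVALENT to the route's target modulo E1′, E2′, D′ and theorems in print; R′ can beat the target
  only through its `p`-adic automorphy hypothesis (non-regular-weight classicality over a field with
  a complex place — `Literature.Barriers.Langlands.NonRegularWeightBarrier`, Calegari 2023 §12),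
  which no landed result uses.

The descent-up-to-twist sector of either parity and the non-descending residue are in
`…DescentSector` (needs the twisting engine `stub_exists_eventually_satakeFrobCompatibleAt_twist`).
-/

noncomputable section

open scoped BigOperators Topology Classical Matrix NumberField MatrixGroups
open Literature.NumberTheory.Automorphic Literature.NumberTheory.GaloisRepresentations
  IsDedekindDomain NumberField Filter

-- `Summit.Langlands.Langlands.…`: summit = sub-problem name (D-0017 nested layout), not a typo.
set_option linter.dupNamespace false

namespace Summit.Langlands.Langlands.Theorems.ArtinWeightRealisationLevel

/-- **The base-change sector, almost-everywhere form, POINTED version.**  Assume strong Artin over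
`ℚ` in Tunnell's a.e. form for the contragredient transports `τ = ι ∘ ρ^∨` of the given `ρ` only
(last hypothesis) and the cuspidality of prime-degree cyclic base change (`hBC : baseChange_cyclic_cuspidal`,
Arthur–Clozel Thm. 4.2 (a)).  Let `K` be a quadratic field, `ι : ℚ̄_p ≃+* ℂ` and
`ρ : Γ_ℚ → GL₂(ℚ̄_p)` continuous of finite image with `ρ|_{Γ_K}` irreducible — NO parity
hypothesis.  Then some cuspidal `π` of `GL₂(𝔸_K)` is Satake–Frobenius compatible with `ρ|_{Γ_K}`
at almost every place of `K`.  Verbatim c14's `eventually_satakeFrobCompatibleAt_restrictField_of_isOdd`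
(p123485) with the oddness bookkeeping deleted: contragredient transport `τ = ι ∘ ρ^∨`, `π_ℚ := π(τ)`
(`hSA`), a non-twist witness at an inert place (`stub_inertNonTwistWitness`), the CUSPIDAL weak
base-change lift `Π = BC_K(π_ℚ)` (`hBC`), `Π = π(τ|_{Γ_K})` a.e. (`stub_bcAscent`) and the pointwise
dictionary `satakeFrobCompatibleAt_iff_of_dual_transport`. [folklore] -/
theorem eventually_satakeFrobCompatibleAt_restrictField_of_piOfDualTransport : Literature.NumberTheory.Automorphic.baseChange_cyclic_cuspidal → ∀ (K : Type) [Field K] [NumberField K], Module.finrank ℚ K = 2 → ∀ (p : ℕ) [Fact p.Prime] (ι : PadicAlgCl p ≃+* ℂ) (ρ : Literature.NumberTheory.GaloisRepresentations.FramedGaloisRep ℚ (PadicAlgCl p) 2), Finite ρ.toMonoidHom.range → (ρ.restrictField K).toGaloisRep.IsIrreducible → (∀ τ : Literature.NumberTheory.GaloisRepresentations.FramedArtinRep ℚ 2, (∀ g : Field.absoluteGaloisGroup ℚ, ((τ g : GL (Fin 2) ℂ) : Matrix (Fin 2) (Fin 2) ℂ) = ((((ρ g)⁻¹ : GL (Fin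 2) (PadicAlgCl p)) : Matrix (Fin 2) (Fin 2) (PadicAlgCl p))ᵀ).map (ι : PadicAlgCl p → ℂ)) → τ.toGaloisRep.IsIrreducible → ∃ (hcpt : Literature.NumberTheory.Automorphic.isCompact_glFiniteIntegralLevel 2 ℚ) (π : Literature.NumberTheory.Automorphic.CuspidalAutomorphicRepData 2 ℚ hcpt), Literature.NumberTheory.Automorphic.IsPiOfArtinRep τ π.1) → ∃ (hcpt : Literature.NumberTheory.Automorphic.isCompact_glFiniteIntegralLevel 2 K) (π : Literature.NumberTheory.Automorphic.CuspidalAutomorphicRepData 2 K hcpt), ∀ᶠ w : IsDedekindDomain.HeightOneSpectrum (NumberField.RingOfIntegers K) in Filter.cofinite, Summit.Langlands.SatakeFrobCompatibleAt ι π.1 (ρ.restrictField K) w := by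
  intro hBC K _ _ hK p _ ι ρ hfin hirr hSA
  set σ : FramedGaloisRep K (PadicAlgCl p) 2 := ρ.restrictField K with hσ
  have hfinσ : Finite σ.toMonoidHom.range := finite_range_restrictField K ρ hfin
  -- (1) contragredient transports of `ρ` (over `ℚ`) and of `σ = ρ|_K` (over `K`)
  obtain ⟨τ, hτ, -, -⟩ := exists_dual_transport_projectiveImage ι ρ hfin
  obtain ⟨τK, hτK, hfinτK, ⟨eK⟩⟩ := exists_dual_transport_projectiveImage ι σ hfinσ
  have heq : τ.restrictField K = τK := by
    refine ContinuousMonoidHom.ext fun g => Units.ext ?_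
    rw [FramedGaloisRep.restrictField_apply, hτ, hτK, hσ, FramedGaloisRep.restrictField_apply]
  -- (2) `τ` is irreducible (its restriction to `Γ_K` is)
  have hirrτK : (τ.restrictField K).toGaloisRep.IsIrreducible := by
    rw [heq]; exact isIrreducible_of_dual_transport σ hirr τK hfinτK eK
  have hirrτ : τ.toGaloisRep.IsIrreducible := isIrreducible_of_isIrreducible_restrictField K τ hirrτK
  -- (3) `π_ℚ = π(τ)` over `ℚ`, and a non-twist witness at an inert place
  obtain ⟨hcptQ, πQ, hπQ⟩ := hSA τ hτ hirrτ
  have hne := stub_inertNonTwistWitness K hK τ hirrτK πQ hπQ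
  -- (4) the cuspidal weak base-change lift `Π = BC_K(π_ℚ)` (Arthur–Clozel Thm. 4.2 (a))
  haveI : Algebra.IsQuadraticExtension ℚ K := ⟨hK⟩
  haveI : IsGalois ℚ K := inferInstance
  have hprime : (Module.finrank ℚ K).Prime := hK ▸ Nat.prime_two
  have hcptK : isCompact_glFiniteIntegralLevel 2 K := isCompact_glFiniteIntegralLevel_holds 2 K
  obtain ⟨P, hlift⟩ := hBC 2 ℚ K hprime hcptQ πQ hne hcptK
  -- (5) `Π = π(τ|_K)` a.e., i.e. a.e. `SatakeFrobCompatibleAt ι Π σ`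
  have hPpi : IsPiOfArtinRep (τ.restrictField K) P.1 := stub_bcAscent τ πQ P hπQ hlift
  rw [heq] at hPpi
  exact ⟨hcptK, P,
    hPpi.mono fun w hw => (satakeFrobCompatibleAt_iff_of_dual_transport ι σ τK hτK P.1 w).2 hw⟩

/-- **The base-change sector of either parity, almost-everywhere form** — strong Artin over `ℚ`
for EVERY irreducible two-dimensional Artin representation (`hSA`) as the displayed hypothesis;
corollary of the pointed version. [folklore] -/
theorem eventually_satakeFrobCompatibleAt_restrictField_of_strongArtin : (∀ ρ : Literature.NumberTheory.GaloisRepresentations.FramedArtinRep ℚ 2, ρ.toGaloisRep.IsIrreducible → ∃ (hcpt : Literature.NumberTheory.Automorphic.isCompact_glFiniteIntegralLevel 2 ℚ) (π : Literature.NumberTheory.Automorphic.CuspidalAutomorphicRepData 2 ℚ hcpt), Literature.NumberTheory.Automorphic.IsPiOfArtinRep ρ π.1) → Literature.NumberTheory.Automorphic.baseChange_cyclic_cuspidal → ∀ (K : Type) [Field K] [NumberField K], Module.finrank ℚ K = 2 → ∀ (p : ℕ) [Fact p.Prime] (ι : PadicAlgCl p ≃+* ℂ) (ρ : Literature.NumberTheory.GaloisRepresentations.FramedGaloisRep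 ℚ (PadicAlgCl p) 2), Finite ρ.toMonoidHom.range → (ρ.restrictField K).toGaloisRep.IsIrreducible → ∃ (hcpt : Literature.NumberTheory.Automorphic.isCompact_glFiniteIntegralLevel 2 K) (π : Literature.NumberTheory.Automorphic.CuspidalAutomorphicRepData 2 K hcpt), ∀ᶠ w : IsDedekindDomain.HeightOneSpectrum (NumberField.RingOfIntegers K) in Filter.cofinite, Summit.Langlands.SatakeFrobCompatibleAt ι π.1 (ρ.restrictField K) w := by
  intro hSA hBC K _ _ hK p _ ι ρ hfin hirr
  exact eventually_satakeFrobCompatibleAt_restrictField_of_piOfDualTransport hBC K hK p ι ρ hfin hirr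
    (fun τ _ hirrτ => hSA τ hirrτ)

/-- **Parity dichotomy over `ℚ`**: a framed Galois representation of `Γ_ℚ` with coefficients in an
integral domain which is not odd is even.  For a complex conjugation `c`, `det ρ(c)² = 1`
(`det_sq_eq_one_of_isComplexConjugation`), so `det ρ(c) = ±1`; `¬ IsOdd` provides one `c₀` with
`det ρ(c₀) = 1`; every ring homomorphism `ℚ →+* ℝ` is the cast, and any two complex conjugations
for it are conjugate in `Γ_ℚ` (`IsComplexConjugation.isConj`), where the determinant is
constant. [folklore] -/
theorem isEven_of_not_isOdd_rat {A : Type} [CommRing A] [IsDomain A] [TopologicalSpace A]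
    {n : ℕ} (ρ : FramedGaloisRep ℚ A n) (h : ¬ ρ.IsOdd) : ρ.IsEven := by
  -- one complex conjugation `c₀` with `det ρ(c₀) ≠ -1`
  obtain ⟨φ₀, c₀, hc₀, hne⟩ : ∃ (φ : ℚ →+* ℝ) (c : Field.absoluteGaloisGroup ℚ),
      IsComplexConjugation φ c ∧ Matrix.GeneralLinearGroup.det (ρ c) ≠ -1 := by
    by_contra hcon
    push Not at hcon
    exact h fun φ c hc => hcon φ c hc
  -- hence `det ρ(c₀) = 1`
  have hdet₀ : Matrix.GeneralLinearGroup.det (ρ c₀) = 1 := by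
    have h1 : ((Matrix.GeneralLinearGroup.det (ρ c₀) : Aˣ) : A) ^ 2 = 1 := by
      rw [← Units.val_pow_eq_pow_val, ρ.det_sq_eq_one_of_isComplexConjugation hc₀, Units.val_one]
    rcases sq_eq_one_iff.mp h1 with h1 | h1
    · exact Units.ext h1
    · exact absurd (Units.ext (by rw [h1, Units.val_neg, Units.val_one])) hne
  -- every complex conjugation is conjugate to `c₀`
  intro φ c hc
  have hφ : φ = φ₀ := Subsingleton.elim _ _
  subst hφ
  obtain ⟨g, hg⟩ := isConj_iff.mp (hc₀.isConj hc)
  rw [← hg, map_mul, map_mul, map_mul, map_mul, map_inv, map_inv, mul_right_comm,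
    mul_inv_cancel, one_mul, hdet₀]

/-- The dihedral groups `D_m` are solvable (every commutator is a rotation, rotations commute).
Re-derived from the private lemma of `Automorphic/StrongArtinGL2OctahedralProofs`. [folklore] -/
theorem dihedralGroup_isSolvable' (m : ℕ) : IsSolvable (DihedralGroup m) := by
  open scoped commutatorElement in
  have hrot : ∀ a b : DihedralGroup m, ∃ k : ZMod m, ⁅a, b⁆ = DihedralGroup.r k := by
    rintro (i | i) (j | j) <;>
      simp only [commutatorElement_def, DihedralGroup.inv_r, DihedralGroup.inv_sr,
        DihedralGroup.r_mul_r, DihedralGroup.r_mul_sr, DihedralGroup.sr_mul_r,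
        DihedralGroup.sr_mul_sr] <;>
      exact ⟨_, rfl⟩
  open scoped commutatorElement in
  have hle : commutator (DihedralGroup m) ≤ Subgroup.zpowers (DihedralGroup.r 1) := by
    rw [commutator_def, Subgroup.commutator_le]
    rintro a - b -
    obtain ⟨k, hk⟩ := hrot a b
    obtain ⟨z, rfl⟩ := ZMod.intCast_surjective k
    rw [hk, ← DihedralGroup.r_one_zpow]
    exact Subgroup.zpow_mem_zpowers _ _
  refine ⟨⟨2, ?_⟩⟩
  rw [derivedSeries_succ, derivedSeries_one, Subgroup.commutator_eq_bot_iff_le_centralizer]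
  intro x hx
  rw [Subgroup.mem_centralizer_iff]
  intro y hy
  obtain ⟨a, rfl⟩ := Subgroup.mem_zpowers_iff.mp (hle hx)
  obtain ⟨b, rfl⟩ := Subgroup.mem_zpowers_iff.mp (hle hy)
  exact ((Commute.refl (DihedralGroup.r (1 : ZMod m))).zpow_zpow b a).eq

/-- **Klein's residue**: an irreducible Artin representation `τ : Γ_F → GL₂(ℂ)` of a number field
whose projective image is NOT solvable is of icosahedral type (projective image `≅ A₅`).  By
Klein's classification (`klein_finite_subgroup_pgl_two_holds`, PROVED) through
`projectiveType_of_isIrreducible` the type is dihedral, tetrahedral, octahedral or icosahedral, and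
`D_m`, `A₄ ≤ S₄`, `S₄` are solvable (`perm_fin_four_isSolvable`). [folklore] -/
theorem isIcosahedralType_of_not_isSolvable {F : Type} [Field F] [NumberField F]
    (τ : FramedArtinRep F 2) (hirr : τ.toGaloisRep.IsIrreducible)
    (hs : ¬ IsSolvable (projectiveImage τ.toMonoidHom)) : IsIcosahedralType τ.toMonoidHom := by
  haveI : Finite τ.toMonoidHom.range := finite_range_toMonoidHom τ
  haveI : IsSolvable (Equiv.Perm (Fin 4)) := Literature.NumberTheory.NumberFields.perm_fin_four_isSolvable
  rcases projectiveType_of_isIrreducible klein_finite_subgroup_pgl_two_holds τ.toMonoidHom hirr with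
    ⟨m, -, ⟨e⟩⟩ | hT | hO | hI
  · haveI := dihedralGroup_isSolvable' m
    exact absurd (solvable_of_surjective (f := (e.symm : DihedralGroup m →* _)) e.symm.surjective) hs
  · obtain ⟨e⟩ := hT
    exact absurd (solvable_of_surjective (f := (e.symm : alternatingGroup (Fin 4) →* _))
      e.symm.surjective) hs
  · obtain ⟨e⟩ := hO
    exact absurd (solvable_of_surjective (f := (e.symm : Equiv.Perm (Fin 4) →* _))
      e.symm.surjective) hs
  · exact hI

/-- **Strong Artin over `ℚ` for `GL₂`, from the route's own target.**  Modulo Langlands–Tunnell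
(`strongArtin_of_isSolvable`), Khare–Wintenberger odd Artin + Booker (odd strong Artin over `ℚ`),
the TARGET of route `ParityBlindBianchi` — `EvenIcosahedralStrongArtin` (item stmt-Langlands-2903:
strong Artin for even icosahedral `ρ : Γ_ℚ → GL₂(ℂ)`) — yields strong Artin in Tunnell's a.e. form
for EVERY irreducible two-dimensional Artin representation of `Γ_ℚ`: solvable projective image →
LT; insoluble ⇒ icosahedral (`isIcosahedralType_of_not_isSolvable`), odd → KW + Booker, not odd ⇒
even (`isEven_of_not_isOdd_rat`) → the target. [folklore] -/
theorem strongArtin_rat_two_of_target : Literature.NumberTheory.Automorphic.strongArtin_of_isSolvable → Literature.NumberTheory.Automorphic.khareWintenberger_artinConjecture_of_isOdd → Literature.NumberTheory.Automorphic.booker_strongArtin_of_artinConjecture → Summit.Langlands.Langlands.Theses.ParityBlindBianchi.EvenIcosahedralStrongArtin → ∀ ρ : Literature.NumberTheory.GaloisRepresentations.FramedArtinRep ℚ 2, ρ.toGaloisRep.IsIrreducible → ∃ (hcpt : Literature.NumberTheory.Automorphic.isCompact_glFiniteIntegralLevel 2 ℚ) (π : Literature.NumberTheory.Automorphic.CuspidalAutomorphicRepData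 2 ℚ hcpt), Literature.NumberTheory.Automorphic.IsPiOfArtinRep ρ π.1 := by
  intro hLT hKW hB hT ρ hirr
  by_cases hs : IsSolvable (projectiveImage ρ.toMonoidHom)
  · exact hLT ρ hirr hs
  by_cases hodd : ρ.IsOdd
  · exact strongArtin_ae_of_isOdd hKW hB ρ hirr hodd
  · exact hT ρ hirr (isIcosahedralType_of_not_isSolvable ρ hirr hs)
      (isEven_of_not_isOdd_rat ρ hodd)


/-- `ρ^∨∨ = ρ` for framed representations (`((((ρ g)⁻¹)ᵀ)⁻¹)ᵀ = ρ g`). [folklore] -/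
theorem dual_dual' {G : Type*} [Group G] [TopologicalSpace G] {A : Type*} [CommRing A] [TopologicalSpace A]
    [IsTopologicalRing A] {n : ℕ} (ρ : FramedRep G A n) : FramedRep.dual (FramedRep.dual ρ) = ρ := by
  refine ContinuousMonoidHom.ext fun g => Units.ext ?_
  rw [FramedRep.coe_dual_apply, ← map_inv, FramedRep.coe_dual_apply_inv, Matrix.transpose_transpose]

/-- **R′ on the literal instance the route consumes, from the route's TARGET** (registered stub).
For `K` imaginary quadratic, `ι : ℚ̄_p ≃+* ℂ` and `σ : Γ_K → GL₂(ℚ̄_p)` a `p`-adic model of `ρ|_{Γ_K}`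
(`ι((σ g)ᵢⱼ) = (ρ|_{Γ_K}(g))ᵢⱼ`) for some `ρ : Γ_ℚ → GL₂(ℂ)` irreducible, projectively `A₅` and
EVEN, the conclusion of `ArtinWeightRealisationLevel` holds modulo three hypotheses only: the
TARGET `EvenIcosahedralStrongArtin` (applied to the contragredient `ρ^∨`, which is again even,
irreducible and icosahedral — `IsEven.dual`, `isIrreducible_dual`, Klein), Arthur–Clozel 4.2 (a)
(`baseChange_cyclic_cuspidal`) and JL (Gelbart 4.1 for every good place).  With
`target_of_even_route_sector` (`…RouteSector`): modulo E1′, E2′, D′ and these print theorems, the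
part of R′ the route consumes is EQUIVALENT to the target. [folklore] -/
theorem even_route_sector_of_target : Summit.Langlands.Langlands.Theses.ParityBlindBianchi.EvenIcosahedralStrongArtin → Literature.NumberTheory.Automorphic.baseChange_cyclic_cuspidal → Literature.NumberTheory.Automorphic.JacquetLanglands1970_twistedHeckeTheoryGL2 → ∀ (K : Type) [Field K] [NumberField K], NumberField.IsTotallyComplex K → Module.finrank ℚ K = 2 → ∀ (p : ℕ) [Fact p.Prime] (ι : PadicAlgCl p ≃+* ℂ) (σ : Literature.NumberTheory.GaloisRepresentations.FramedGaloisRep K (PadicAlgCl p) 2), Finite σ.toMonoidHom.range → σ.toGaloisRep.IsIrreducible → (∃ ρ : Literature.NumberTheory.GaloisRepresentations.FramedArtinRep ℚ 2, ρ.toGaloisRep.IsIrreducible ∧ Nonempty ((Matrix.ProjGenLinGroup.mk.comp ρ.toMonoidHom).range ≃* alternatingGroup (Fin 5)) ∧ (∀ (φ : ℚ →+* ℝ) (c : Field.absoluteGaloisGroup ℚ), Literature.NumberTheory.GaloisRepresentations.IsComplexConjugation φ c → Matrix.GeneralLinearGroup.det (ρ c) = 1) ∧ ∀ (g : Field.absoluteGaloisGroup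 K) (i j : Fin 2), ι ((σ g).val i j) = ((Literature.NumberTheory.GaloisRepresentations.FramedGaloisRep.restrictField K ρ) g).val i j) → ∀ S₀ : Finset ℕ, p ∈ S₀ → (∃ (U : Subgroup (GL (Fin 2) (IsDedekindDomain.FiniteAdeleRing (NumberField.RingOfIntegers K) K))) (ϖ : ∀ v : IsDedekindDomain.HeightOneSpectrum (NumberField.RingOfIntegers K), (v.adicCompletion K)ˣ) (a : {v : IsDedekindDomain.HeightOneSpectrum (NumberField.RingOfIntegers K) // ∀ ℓ ∈ S₀, ((ℓ : ℕ) : NumberField.RingOfIntegers K) ∉ v.asIdeal} → ℕ → (Valued.v (R := PadicAlgCl p)).valuationSubring), IsOpen (U : Set (GL (Fin 2) (IsDedekindDomain.FiniteAdeleRing (NumberField.RingOfIntegers K) K))) ∧ U ≤ Literature.NumberTheory.Automorphic.glFiniteIntegralLevel 2 K ∧ (∀ g ∈ Literature.NumberTheory.Automorphic.glFiniteIntegralLevel 2 K, (∀ v : IsDedekindDomain.HeightOneSpectrum (NumberField.RingOfIntegers K), ¬ (∀ ℓ ∈ S₀, ((ℓ : ℕ) : NumberField.RingOfIntegers K) ∉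 v.asIdeal) → ∀ i j : Fin 2, ((g : Matrix (Fin 2) (Fin 2) (IsDedekindDomain.FiniteAdeleRing (NumberField.RingOfIntegers K) K)) i j) v = (1 : Matrix (Fin 2) (Fin 2) (v.adicCompletion K)) i j) → g ∈ U) ∧ (∀ v : IsDedekindDomain.HeightOneSpectrum (NumberField.RingOfIntegers K), Valued.v ((ϖ v : (v.adicCompletion K)ˣ) : v.adicCompletion K) = WithZero.exp (-1 : ℤ)) ∧ Literature.NumberTheory.Automorphic.IsHeckePoint (Matrix.GeneralLinearGroup.map (n := Fin 2) (algebraMap K (IsDedekindDomain.FiniteAdeleRing (NumberField.RingOfIntegers K) K))) (Literature.NumberTheory.Automorphic.LevelTower.ofSeq U (fun r : ℕ => (Literature.NumberTheory.Automorphic.principalCongruenceLevel 2 K (Ideal.span {((p : ℕ) : NumberField.RingOfIntegers K)} ^ r)).map (Literature.NumberTheory.Automorphic.GLn.sndHom 2 K))) ((p : ℕ) : (Valued.v (R := PadicAlgCl p)).valuationSubring) (fun j : {v : IsDedekindDomain.HeightOneSpectrum (NumberField.RingOfIntegers K) // ∀ ℓ ∈ S₀, ((ℓ : ℕ) : NumberField.RingOfIntegers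 K) ∉ v.asIdeal} × Fin 2 => Literature.NumberTheory.Automorphic.GLn.sndHom 2 K (Literature.NumberTheory.Automorphic.heckeDiagAt 2 K j.1.1 (ϖ j.1.1) (j.2.val + 1))) (fun j => a j.1 (j.2.val + 1)) ∧ ∀ (v : IsDedekindDomain.HeightOneSpectrum (NumberField.RingOfIntegers K)) (hv : ∀ ℓ ∈ S₀, ((ℓ : ℕ) : NumberField.RingOfIntegers K) ∉ v.asIdeal), σ.IsHeckeAssociatedAt v (fun i : ℕ => if i = 0 then (1 : PadicAlgCl p) else ((a ⟨v, hv⟩ i : (Valued.v (R := PadicAlgCl p)).valuationSubring) : PadicAlgCl p))) → ∃ (hcpt : Literature.NumberTheory.Automorphic.isCompact_glFiniteIntegralLevel 2 K) (π : Literature.NumberTheory.Automorphic.CuspidalAutomorphicRepData 2 K hcpt), ∀ w : IsDedekindDomain.HeightOneSpectrum (NumberField.RingOfIntegers K), (∀ ℓ ∈ S₀, ((ℓ : ℕ) : NumberField.RingOfIntegers K) ∉ w.asIdeal) → Summit.Langlands.SatakeFrobCompatibleAt ι π.1 σ w := by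
  intro hT hBC hJL K _ _ _ hdeg p _ ι σ hfin _ hsec S₀ _ hyp
  obtain ⟨ρ, hirrρ, ⟨e⟩, heven, hmodel⟩ := hsec
  -- the `p`-adic model `ρ' = ι⁻¹ ∘ ρ` of `ρ`, with `ρ'|_K = σ`
  haveI : Finite ρ.toMonoidHom.range := finite_range_toMonoidHom ρ
  obtain ⟨ρ', hρ', hfin', -⟩ := ResidualBianchiDoorMod2.exists_map_ringEquiv ρ ι.symm
  have hres : ρ'.restrictField K = σ := by
    refine ContinuousMonoidHom.ext fun g => Units.ext (Matrix.ext fun i j => ?_)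
    have h1 : ρ'.toMonoidHom (absGaloisRestrict ℚ K g) =
        (Matrix.GeneralLinearGroup.map ι.symm.toRingHom) (ρ (absGaloisRestrict ℚ K g)) := by
      rw [hρ']; rfl
    have h2 : ((ρ'.restrictField K) g).val i j = ι.symm ((ρ (absGaloisRestrict ℚ K g)).val i j) := by
      change (ρ'.toMonoidHom (absGaloisRestrict ℚ K g)).val i j = _
      rw [h1]; rfl
    rw [h2, ← FramedGaloisRep.restrictField_apply, ← hmodel g i j, RingEquiv.symm_apply_apply]
  have hirr' : (ρ'.restrictField K).toGaloisRep.IsIrreducible := by rw [hres]; assumption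
  -- strong Artin for the contragredient transport `τ = ι ∘ ρ'^∨ = ρ^∨`, from the TARGET
  have hSA : ∀ τ : FramedArtinRep ℚ 2, (∀ g : Field.absoluteGaloisGroup ℚ,
      ((τ g : GL (Fin 2) ℂ) : Matrix (Fin 2) (Fin 2) ℂ) =
        ((((ρ' g)⁻¹ : GL (Fin 2) (PadicAlgCl p)) : Matrix (Fin 2) (Fin 2) (PadicAlgCl p))ᵀ).map
          (ι : PadicAlgCl p → ℂ)) → τ.toGaloisRep.IsIrreducible →
      ∃ (hcpt : isCompact_glFiniteIntegralLevel 2 ℚ) (π : CuspidalAutomorphicRepData 2 ℚ hcpt),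
        IsPiOfArtinRep τ π.1 := by
    intro τ hτ _
    -- `τ = ρ^∨`
    have hτd : τ = FramedRep.dual ρ := by
      refine ContinuousMonoidHom.ext fun g => Units.ext ?_
      have h1 : ρ' g = (Matrix.GeneralLinearGroup.map ι.symm.toRingHom) (ρ g) := by
        change ρ'.toMonoidHom g = _
        rw [hρ']; rfl
      rw [hτ g, FramedRep.coe_dual_apply, h1, ← map_inv]
      change ((((ρ g)⁻¹ : GL (Fin 2) ℂ) : Matrix (Fin 2) (Fin 2) ℂ).map
        (ι.symm : ℂ → PadicAlgCl p))ᵀ.map (ι : PadicAlgCl p → ℂ) = _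
      rw [Matrix.transpose_map, Matrix.map_map]
      have hid : ((ι : PadicAlgCl p → ℂ) ∘ (ι.symm : ℂ → PadicAlgCl p)) = id :=
        funext fun x => ι.apply_symm_apply x
      rw [hid, Matrix.map_id]
    subst hτd
    refine hT (FramedRep.dual ρ) (FramedRep.isIrreducible_dual ρ hirrρ) ?_ (FramedGaloisRep.IsEven.dual heven)
    -- `ρ^∨` is icosahedral: irreducible with insoluble projective image (`A₅` is not solvable)
    refine isIcosahedralType_of_not_isSolvable (FramedRep.dual ρ) (FramedRep.isIrreducible_dual ρ hirrρ) ?_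
    intro hs
    have hs' : IsSolvable (projectiveImage ρ.toMonoidHom) := by
      rw [isSolvable_projectiveImage_iff] at hs ⊢
      have h := FramedRep.isSolvable_range_dual (FramedRep.dual ρ) hs
      rwa [dual_dual'] at h
    haveI : IsSolvable (Matrix.ProjGenLinGroup.mk.comp ρ.toMonoidHom).range := hs'
    exact alternatingGroup_five_not_isSolvable
      (solvable_of_surjective (f := (e.toMonoidHom : projectiveImage ρ.toMonoidHom →* alternatingGroup (Fin 5)))
        e.surjective)
  -- the base-change chain for `ρ'`, then every good place by rigidity (JL ⇒ Gelbart 4.1)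
  obtain ⟨hcpt, π, hae⟩ :=
    eventually_satakeFrobCompatibleAt_restrictField_of_piOfDualTransport hBC K hdeg p ι ρ' hfin' hirr' hSA
  have hG : frobSatakeCompatibleAt_of_isPiOfArtinRep_of_isUnramifiedAt :=
    frobSatakeCompatibleAt_of_isPiOfArtinRep_of_isUnramifiedAt_of_JacquetLanglands1970_twistedHeckeTheoryGL2 hJL
  rw [hres] at hae
  refine ⟨hcpt, π, fun w hw => satakeFrobCompatibleAt_of_eventually_of_isUnramifiedAt
    (fun hcpt τ π hπ v hv => hG hcpt τ π hπ v hv) K p ι σ hfin hcpt π hae w ?_⟩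
  obtain ⟨U, ϖ, a, -, -, -, -, -, hassoc⟩ := hyp
  exact (hassoc w hw).isUnramifiedAt

end Summit.Langlands.Langlands.Theorems.ArtinWeightRealisationLevel

end
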